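import Summits.CriticalPhenomena.PercolationContinuityZ3.Theorems.Transplant.SkelFrmQuasiBParamsFaceFloorsTXAR0
import Summits.CriticalPhenomena.PercolationContinuityZ3.Theorems.Transplant.SkelFrmBParamsFaceFloorsTXAR0
import Summits.CriticalPhenomena.PercolationContinuityZ3.Theorems.Transplant.SkelFrmQuasiBParamsFaceRunA
import Summits.CriticalPhenomena.PercolationContinuityZ3.Theorems.Transplant.SkelFrmBParamsFaceRunA
import Summits.CriticalPhenomena.PercolationContinuityZ3.Theorems.Transplant.SkelFrmQuasiBParamsFaceCountsRangeA
import Summits.CriticalPhenomena.PercolationContinuityZ3.Theorems.Transplant.SkelFrmBParamsFaceCountsRangeA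
import Summits.CriticalPhenomena.PercolationContinuityZ3.Theorems.Transplant.SkelFrmFromBParamsKitA
import Summits.CriticalPhenomena.PercolationContinuityZ3.Theorems.Transplant.SkelFrmBParamsKitA
import Summits.CriticalPhenomena.PercolationContinuityZ3.Theorems.Transplant.SkelPhiFaceNumsYFace
import Summits.CriticalPhenomena.PercolationContinuityZ3.Theorems.Transplant.SkelNegBParamsFaceFloorsFTYA
import Summits.CriticalPhenomena.PercolationContinuityZ3.Theorems.Transplant.PlanarSkeletonFrmQuasiDefs
import Summits.CriticalPhenomena.PercolationContinuityZ3.Theorems.Transplant.PlanarSkeletonFrmDefs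
import Summits.CriticalPhenomena.PercolationContinuityZ3.Theorems.Transplant.SkelPhiStepIDataNS
import Summits.CriticalPhenomena.PercolationContinuityZ3.Theorems.Transplant.SkelFrmQuasi1ChoiceDefs
import Summits.CriticalPhenomena.PercolationContinuityZ3.Theorems.Transplant.SkelFrmQuasi1ParamsLBL
import Summits.CriticalPhenomena.PercolationContinuityZ3.Theorems.Transplant.SkelFrmQuasiBChoiceNums
import Summits.CriticalPhenomena.PercolationContinuityZ3.Theorems.Transplant.SkelFrmQuasiBParamsFaceUnits
import Summits.CriticalPhenomena.PercolationContinuityZ3.Theorems.Transplant.SkelFrmQuasiBParamsLF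
import HarnessLib
import Summits.CriticalPhenomena.PercolationContinuityZ3.Theorems.Transplant.SkelFrmBParamsFaceFloorsFTYA
/-!
# GEN-Q PORT (WAVE-Q table v0.8 section 2, row G170, U-level L18; captain R-6/R-7 2026-08-27: carrier token swap `PlanarSkeletonFrmFrom ↦ PlanarSkeletonFrmQuasi`)
# of the tree module «Transplant/SkelFrmFromBParamsFaceFloorsFTYA» (sha256 cf4806b5a13edea2…) onto the quasi-step carrier `PlanarSkeletonFrmQuasi` (p507026): «SkelFrmQuasiBParamsFaceFloorsFTYA»

HAND HUNK (L-FLOORMAP-1 ①⑥ / L-KitS-1 reader side; G017 «SkelFrmQuasiBChoiceNums», hp-8's KitSN): KS0.R'0→KS0.R'0N×45 — the kit of record at window cost `KS.NQ Φ`.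

ORIGINAL TITLE: (F) VALUE LAYER, N2 twin (hp-8 g42, 2026-08-23; F-DISCHARGE-MAP-N2 G18 y′-face tangential floors FT1–FT6; (R-22)/E6): `port_frm.py` text of N1 `SkelNegBParamsFaceFloorsFTYA`

builds on p205010 (kernel theorem, internal audit signed; external expert review pending) — nothing in this file uses p205010; NOTHING is claimed about any open node
((N3-b), the end state).  Lane `prim-bschramm`, seat `prim-bschramm-stmt` (gen 33; GEN-Q column pen; tool = captain gen-1 g4's port_genq.py R-14 --cone + p3-g30's T1 patch).  Helper file (`--supports stmt-CriticalPhenomena-4575 --as helper`).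
PORT RULES (U-wave r1–r4 re-used, GEN-Q hunk classes of p3-g29 #6136): declaration order, names and proof texts are those of «SkelFrmFromBParamsFaceFloorsFTYA», byte-identical except
(i) the carrier token `PlanarSkeletonFrmFrom ↦ PlanarSkeletonFrmQuasi` in binders, `namespace`/`end` lines and qualified names (module names `SkelFrmFrom… ↦ SkelFrmQuasi…`
in imports of already-ported rows); (ii) `Φ.step ↦ Φ.qstep` with the called Steps lemma replaced by its `…Q`/`_q` twin and the cost `Φ.M` threaded (none in this file unless
listed below); (iii) `Φ.cyl_connected ↦ Φ.cyl_reach` readers (none unless listed); (iv) graph-ball radii / window floors ×`Φ.M` (none unless listed).  Carrier-free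
residents stay imported/exported from the original «SkelFrmBParamsFaceFloorsFTYA» exactly as in the FrmFrom port.  Docstrings and citations are the original's.

-/

noncomputable section

open scoped Classical

namespace Summit.CriticalPhenomena.PercolationContinuityZ3.Theorems.Transplant

namespace PlanarSkeletonFrmQuasi

namespace NegB

open Literature.Probability.Percolation Literature.Probability.LatticeModels SimpleGraph
open SkelConc (Consts)
open Skelφ (shearUnit xBoxB xBoxLoA xBoxHiA xSLo xSHi)
open Skelφ.StepI (DataN)
open TwoAxis.Para (modulus)
open Neg

namespace KS

/-! ## §1 The signed along boxes of a tangential x-run and the band room -/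

export PlanarSkeletonNeg.NegB.KS (xSBox_eq)

/-! (N2, J21-candidate, hp-8 g42 09:45Z: N1's band-room lemma `hkE24_RA₂ : 2·kFF₂ + 24u + 24 ≤ 5r⊥` is NOT re-ported — with staggered
cells the room about an off-centre contact also pays the creep `P.c icr`, so the consumer (PinSYA-N2) takes the creep-aware row
`hkE24c : 2·kE + 24·u₀A + 24 + 2·P.c 1 ≤ 5·P.r 0` as a hypothesis, discharged by the value rows of record.) -/

/-! ## §2 The floors -/

section FloorsTY

/-- `2 ≤ m` under the numeric long clause and `22000·Kq·(RA′+2) ≤ ℓ_L` (`m > n_Lℓ_L − n_L ≥ ℓ_L − 1`). [folklore] -/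
theorem two_le_modulus (κ : Consts) {V : Type} [DecidableEq V] [Countable V] {G : SimpleGraph V} [G.LocallyFinite] (Φ : PlanarSkeletonFrmQuasi G) (t : V) (p : unitInterval) (D : Skelφ.StepI.DataNS V) (g : ℕ) (f : ℕ) (mk : ℕ) (hN : EqNumL κ Φ t p D g f)
    (hℓ : 22000 * Neg.Kq κ * (KS0.R'0N κ Φ (KS.NQ Φ) t p D mk + 2) ≤ ℓL κ Φ t p D g f) :
    2 ≤ modulus (nL κ Φ t p D g f) (hL κ Φ t p D g f) (vL κ Φ t p D g f) (vβL κ Φ t p D g f) := by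
  obtain ⟨hn1, hℓ1⟩ := one_le_of_eqNumL κ Φ t p D g f hN
  have hm := (Skelφ.NegPrm.modulus_vβOf hn1 (hL κ Φ t p D g f) (ℓL κ Φ t p D g f) (vL κ Φ t p D g f)).1
  have e : vβL κ Φ t p D g f = Skelφ.NegPrm.vβOf (nL κ Φ t p D g f) (hL κ Φ t p D g f) (ℓL κ Φ t p D g f) (vL κ Φ t p D g f) := rfl
  rw [← e] at hm
  have hℓ' : 22000 * (Neg.Kq κ : ℤ) * ((KS0.R'0N κ Φ (KS.NQ Φ) t p D mk : ℤ) + 2) ≤ (ℓL κ Φ t p D g f : ℤ) := by exact_mod_cast hℓ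
  have hKq : (1 : ℤ) ≤ (Neg.Kq κ : ℤ) := by exact_mod_cast Neg.one_le_Kq κ
  have hR0 : (0 : ℤ) ≤ (KS0.R'0N κ Φ (KS.NQ Φ) t p D mk : ℤ) := Nat.cast_nonneg _
  have hn : (1 : ℤ) ≤ (nL κ Φ t p D g f : ℤ) := by exact_mod_cast hn1
  have hKR : (0 : ℤ) ≤ (Neg.Kq κ : ℤ) * (KS0.R'0N κ Φ (KS.NQ Φ) t p D mk : ℤ) := mul_nonneg (by linarith) hR0
  have h1 : (1 : ℤ) * ((ℓL κ Φ t p D g f : ℤ) - 1) ≤ (nL κ Φ t p D g f : ℤ) * ((ℓL κ Φ t p D g f : ℤ) - 1) :=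
    mul_le_mul_of_nonneg_right hn (by nlinarith)
  nlinarith

/-- **`FT1` at the (ζ′) y′-face tuple** (`σ = 1`): the lower axis-`1` reading of tangential region `k` is above `flo`, given `hnear : flo + 5u₁ + 1 ≤ F1cA yT`.
[cite: KozmaNitzan2024, §4 Lemma 12 (pp. 23–25)] -/
theorem FT1_YA (κ : Consts) {V : Type} [DecidableEq V] [Countable V] {G : SimpleGraph V} [G.LocallyFinite] (Φ : PlanarSkeletonFrmQuasi G) (t : V) (p : unitInterval) (D : Skelφ.StepI.DataNS V) (g : ℕ) (f : ℕ) (P : PCells2T) (mk : ℕ) (hN : EqNumL κ Φ t p D g f) (hκ : (hL κ Φ t p D g f).natAbs ≤ 10 * nL κ Φ t p D g f)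
    (hℓ : 22000 * Neg.Kq κ * (KS0.R'0N κ Φ (KS.NQ Φ) t p D mk + 2) ≤ ℓL κ Φ t p D g f) (yT : Site 2) {lev : ℤ} {j k : ℕ} (hk : k + 1 ≤ 1000 * Neg.Kq κ)
    (hnear : 5 * (P.r 1 : ℤ) + 10 * u₁A κ Φ t p D g f * (j : ℤ) + 3 - lev + 5 * u₁A κ Φ t p D g f + 1 ≤ F1cA κ Φ t p D g f yT) :
    modulus (nL κ Φ t p D g f) (hL κ Φ t p D g f) (vL κ Φ t p D g f) (vβL κ Φ t p D g f) *
        ((5 * (P.r 1 : ℤ) + 10 * u₁A κ Φ t p D g f * (j : ℤ) + 3 - lev) - F1cA κ Φ t p D g f yT) ≤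
      -(u₁A κ Φ t p D g f * (shearUnit (nL κ Φ t p D g f) (hL κ Φ t p D g f) : ℤ) *
          (xBoxB (nL κ Φ t p D g f) (ℓL κ Φ t p D g f) (hL κ Φ t p D g f) (KS0.R'0N κ Φ (KS.NQ Φ) t p D mk) k + 1)) -
        modulus (nL κ Φ t p D g f) (hL κ Φ t p D g f) (vL κ Φ t p D g f) (vβL κ Φ t p D g f) + 1 := by
  obtain ⟨hn1, hℓ1⟩ := one_le_of_eqNumL κ Φ t p D g f hN
  have hm2 := two_le_modulus κ Φ t p D g f mk hN hℓ
  have hu : 1 ≤ u₁A κ Φ t p D g f := (units_eqA κ Φ t p D g f).2.2.2.2.2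
  have hsl := slant_leR0 κ Φ t p D g f mk hN hκ hℓ hk (by linarith : 0 ≤ u₁A κ Φ t p D g f)
  clear hℓ hk hκ
  set m := modulus (nL κ Φ t p D g f) (hL κ Φ t p D g f) (vL κ Φ t p D g f) (vβL κ Φ t p D g f)
  set u := u₁A κ Φ t p D g f
  set F := F1cA κ Φ t p D g f yT
  set S := (shearUnit (nL κ Φ t p D g f) (hL κ Φ t p D g f) : ℤ) * (xBoxB (nL κ Φ t p D g f) (ℓL κ Φ t p D g f) (hL κ Φ t p D g f) (KS0.R'0N κ Φ (KS.NQ Φ) t p D mk) k + 1)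
  set flo := 5 * (P.r 1 : ℤ) + 10 * u * (j : ℤ) + 3 - lev
  have h1 : m * (flo - F) ≤ m * (-(5 * u) - 1) := mul_le_mul_of_nonneg_left (by linarith) (by linarith)
  have h2 : (1 : ℤ) * 2 ≤ u * m := mul_le_mul hu hm2 (by norm_num) (by linarith)
  nlinarith

/-- **`FT2` at the (ζ′) y′-face tuple** (`σ = 1`): the upper axis-`1` reading of tangential region `k` is below `fhi`, given `hfar : F1cA yT + 5u₁ + 1 ≤ fhi`.
[cite: KozmaNitzan2024, §4 Lemma 12 (pp. 23–25)] -/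
theorem FT2_YA (κ : Consts) {V : Type} [DecidableEq V] [Countable V] {G : SimpleGraph V} [G.LocallyFinite] (Φ : PlanarSkeletonFrmQuasi G) (t : V) (p : unitInterval) (D : Skelφ.StepI.DataNS V) (g : ℕ) (f : ℕ) (P : PCells2T) (mk : ℕ) (hN : EqNumL κ Φ t p D g f) (hκ : (hL κ Φ t p D g f).natAbs ≤ 10 * nL κ Φ t p D g f)
    (hℓ : 22000 * Neg.Kq κ * (KS0.R'0N κ Φ (KS.NQ Φ) t p D mk + 2) ≤ ℓL κ Φ t p D g f) (yT : Site 2) {lev : ℤ} {k : ℕ} (hk : k + 1 ≤ 1000 * Neg.Kq κ)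
    (hfar : F1cA κ Φ t p D g f yT + 5 * u₁A κ Φ t p D g f + 1 ≤ 25 * (P.r 1 : ℤ) - 2 - lev) :
    modulus (nL κ Φ t p D g f) (hL κ Φ t p D g f) (vL κ Φ t p D g f) (vβL κ Φ t p D g f) * (F1cA κ Φ t p D g f yT + 1) +
        u₁A κ Φ t p D g f * ((shearUnit (nL κ Φ t p D g f) (hL κ Φ t p D g f) : ℤ) *
            xBoxB (nL κ Φ t p D g f) (ℓL κ Φ t p D g f) (hL κ Φ t p D g f) (KS0.R'0N κ Φ (KS.NQ Φ) t p D mk) k +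
          shearUnit (nL κ Φ t p D g f) (hL κ Φ t p D g f) - 1) ≤
      modulus (nL κ Φ t p D g f) (hL κ Φ t p D g f) (vL κ Φ t p D g f) (vβL κ Φ t p D g f) * (25 * (P.r 1 : ℤ) - 2 - lev) := by
  obtain ⟨hn1, hℓ1⟩ := one_le_of_eqNumL κ Φ t p D g f hN
  have hm2 := two_le_modulus κ Φ t p D g f mk hN hℓ
  have hu : 1 ≤ u₁A κ Φ t p D g f := (units_eqA κ Φ t p D g f).2.2.2.2.2
  have hsl := slant_leR0 κ Φ t p D g f mk hN hκ hℓ hk (by linarith : 0 ≤ u₁A κ Φ t p D g f)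
  clear hℓ hk hκ
  set m := modulus (nL κ Φ t p D g f) (hL κ Φ t p D g f) (vL κ Φ t p D g f) (vβL κ Φ t p D g f)
  set u := u₁A κ Φ t p D g f
  set F := F1cA κ Φ t p D g f yT
  set U : ℤ := (shearUnit (nL κ Φ t p D g f) (hL κ Φ t p D g f) : ℤ)
  set X := xBoxB (nL κ Φ t p D g f) (ℓL κ Φ t p D g f) (hL κ Φ t p D g f) (KS0.R'0N κ Φ (KS.NQ Φ) t p D mk) k
  set fhi := 25 * (P.r 1 : ℤ) - 2 - lev
  have e : u * (U * X + U - 1) = u * (U * (X + 1)) - u := by ring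
  have h1 : m * (F + 5 * u + 1) ≤ m * fhi := mul_le_mul_of_nonneg_left hfar (by linarith)
  rw [e]
  nlinarith

/-- **`FT3` at the (ζ′) y′-face tuple** (`σ = −1`): mirror of `FT1`, given `hnear : flo + 5u₁ + 1 ≤ −F1cA yT`. [cite: KozmaNitzan2024, §4 Lemma 12 (pp. 23–25)] -/
theorem FT3_YA (κ : Consts) {V : Type} [DecidableEq V] [Countable V] {G : SimpleGraph V} [G.LocallyFinite] (Φ : PlanarSkeletonFrmQuasi G) (t : V) (p : unitInterval) (D : Skelφ.StepI.DataNS V) (g : ℕ) (f : ℕ) (P : PCells2T) (mk : ℕ) (hN : EqNumL κ Φ t p D g f) (hκ : (hL κ Φ t p D g f).natAbs ≤ 10 * nL κ Φ t p D g f)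
    (hℓ : 22000 * Neg.Kq κ * (KS0.R'0N κ Φ (KS.NQ Φ) t p D mk + 2) ≤ ℓL κ Φ t p D g f) (yT : Site 2) {lev : ℤ} {j k : ℕ} (hk : k + 1 ≤ 1000 * Neg.Kq κ)
    (hnear : 5 * (P.r 1 : ℤ) + 10 * u₁A κ Φ t p D g f * (j : ℤ) + 3 - lev + 5 * u₁A κ Φ t p D g f + 1 ≤ -F1cA κ Φ t p D g f yT) :
    modulus (nL κ Φ t p D g f) (hL κ Φ t p D g f) (vL κ Φ t p D g f) (vβL κ Φ t p D g f) *
        ((5 * (P.r 1 : ℤ) + 10 * u₁A κ Φ t p D g f * (j : ℤ) + 3 - lev) + F1cA κ Φ t p D g f yT + 1) ≤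
      -(u₁A κ Φ t p D g f * ((shearUnit (nL κ Φ t p D g f) (hL κ Φ t p D g f) : ℤ) *
            xBoxB (nL κ Φ t p D g f) (ℓL κ Φ t p D g f) (hL κ Φ t p D g f) (KS0.R'0N κ Φ (KS.NQ Φ) t p D mk) k +
          shearUnit (nL κ Φ t p D g f) (hL κ Φ t p D g f) - 1)) := by
  obtain ⟨hn1, hℓ1⟩ := one_le_of_eqNumL κ Φ t p D g f hN
  have hm2 := two_le_modulus κ Φ t p D g f mk hN hℓ
  have hu : 1 ≤ u₁A κ Φ t p D g f := (units_eqA κ Φ t p D g f).2.2.2.2.2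
  have hsl := slant_leR0 κ Φ t p D g f mk hN hκ hℓ hk (by linarith : 0 ≤ u₁A κ Φ t p D g f)
  clear hℓ hk hκ
  set m := modulus (nL κ Φ t p D g f) (hL κ Φ t p D g f) (vL κ Φ t p D g f) (vβL κ Φ t p D g f)
  set u := u₁A κ Φ t p D g f
  set F := F1cA κ Φ t p D g f yT
  set U : ℤ := (shearUnit (nL κ Φ t p D g f) (hL κ Φ t p D g f) : ℤ)
  set X := xBoxB (nL κ Φ t p D g f) (ℓL κ Φ t p D g f) (hL κ Φ t p D g f) (KS0.R'0N κ Φ (KS.NQ Φ) t p D mk) k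
  set flo := 5 * (P.r 1 : ℤ) + 10 * u * (j : ℤ) + 3 - lev
  have e : u * (U * X + U - 1) = u * (U * (X + 1)) - u := by ring
  have h1 : m * (flo + F + 1) ≤ m * (-(5 * u)) := mul_le_mul_of_nonneg_left (by linarith) (by linarith)
  rw [e]
  nlinarith

/-- **`FT4` at the (ζ′) y′-face tuple** (`σ = −1`): mirror of `FT2`, given `hfar : −F1cA yT + 5u₁ + 1 ≤ fhi`. [cite: KozmaNitzan2024, §4 Lemma 12 (pp. 23–25)] -/
theorem FT4_YA (κ : Consts) {V : Type} [DecidableEq V] [Countable V] {G : SimpleGraph V} [G.LocallyFinite] (Φ : PlanarSkeletonFrmQuasi G) (t : V) (p : unitInterval) (D : Skelφ.StepI.DataNS V) (g : ℕ) (f : ℕ) (P : PCells2T) (mk : ℕ) (hN : EqNumL κ Φ t p D g f) (hκ : (hL κ Φ t p D g f).natAbs ≤ 10 * nL κ Φ t p D g f)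
    (hℓ : 22000 * Neg.Kq κ * (KS0.R'0N κ Φ (KS.NQ Φ) t p D mk + 2) ≤ ℓL κ Φ t p D g f) (yT : Site 2) {lev : ℤ} {k : ℕ} (hk : k + 1 ≤ 1000 * Neg.Kq κ)
    (hfar : -F1cA κ Φ t p D g f yT + 5 * u₁A κ Φ t p D g f + 1 ≤ 25 * (P.r 1 : ℤ) - 2 - lev) :
    -(modulus (nL κ Φ t p D g f) (hL κ Φ t p D g f) (vL κ Φ t p D g f) (vβL κ Φ t p D g f) * F1cA κ Φ t p D g f yT) +
          u₁A κ Φ t p D g f * (shearUnit (nL κ Φ t p D g f) (hL κ Φ t p D g f) : ℤ) *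
            (xBoxB (nL κ Φ t p D g f) (ℓL κ Φ t p D g f) (hL κ Φ t p D g f) (KS0.R'0N κ Φ (KS.NQ Φ) t p D mk) k + 1) +
        modulus (nL κ Φ t p D g f) (hL κ Φ t p D g f) (vL κ Φ t p D g f) (vβL κ Φ t p D g f) - 1 ≤
      modulus (nL κ Φ t p D g f) (hL κ Φ t p D g f) (vL κ Φ t p D g f) (vβL κ Φ t p D g f) * (25 * (P.r 1 : ℤ) - 2 - lev) := by
  obtain ⟨hn1, hℓ1⟩ := one_le_of_eqNumL κ Φ t p D g f hN
  have hm2 := two_le_modulus κ Φ t p D g f mk hN hℓ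
  have hu : 1 ≤ u₁A κ Φ t p D g f := (units_eqA κ Φ t p D g f).2.2.2.2.2
  have hsl := slant_leR0 κ Φ t p D g f mk hN hκ hℓ hk (by linarith : 0 ≤ u₁A κ Φ t p D g f)
  clear hℓ hk hκ
  set m := modulus (nL κ Φ t p D g f) (hL κ Φ t p D g f) (vL κ Φ t p D g f) (vβL κ Φ t p D g f)
  set u := u₁A κ Φ t p D g f
  set F := F1cA κ Φ t p D g f yT
  set S := (shearUnit (nL κ Φ t p D g f) (hL κ Φ t p D g f) : ℤ) * (xBoxB (nL κ Φ t p D g f) (ℓL κ Φ t p D g f) (hL κ Φ t p D g f) (KS0.R'0N κ Φ (KS.NQ Φ) t p D mk) k + 1)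
  set fhi := 25 * (P.r 1 : ℤ) - 2 - lev
  have h1 : m * (-F + 5 * u + 1) ≤ m * fhi := mul_le_mul_of_nonneg_left hfar (by linarith)
  nlinarith

/-- The size of the signed along box's half-width at the (ζ′) y′-face tuple: `qB3YA (RA′) + (k+1)·RA′ + n_L ≤ 4·n_L` (`k + 1 ≤ 1000·Kq`, `2000·Kq·(RA′+2) ≤ n_L`). [folklore] -/
theorem xSBox_hw_le (κ : Consts) {V : Type} [DecidableEq V] [Countable V] {G : SimpleGraph V} [G.LocallyFinite] (Φ : PlanarSkeletonFrmQuasi G) (t : V) (p : unitInterval) (D : Skelφ.StepI.DataNS V) (g : ℕ) (f : ℕ) (mk : ℕ) (hnA : 2000 * Neg.Kq κ * (KS0.R'0N κ Φ (KS.NQ Φ) t p D mk + 2) ≤ nL κ Φ t p D g f) {k : ℕ} (hk : k + 1 ≤ 1000 * Neg.Kq κ) :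
    ((qB3YA κ Φ t p D g f (KS0.R'0N κ Φ (KS.NQ Φ) t p D mk) : ℕ) : ℤ) + ((k : ℤ) + 1) * (KS0.R'0N κ Φ (KS.NQ Φ) t p D mk : ℕ) + (nL κ Φ t p D g f : ℤ) ≤ 4 * (nL κ Φ t p D g f : ℤ) := by
  have hq3 : ((qB3YA κ Φ t p D g f (KS0.R'0N κ Φ (KS.NQ Φ) t p D mk) : ℕ) : ℤ) = 2 * (nL κ Φ t p D g f : ℤ) + 1000 * (Neg.Kq κ : ℤ) * (KS0.R'0N κ Φ (KS.NQ Φ) t p D mk : ℤ) := by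
    unfold qB3YA; push_cast; ring
  have hnA' : 2000 * (Neg.Kq κ : ℤ) * ((KS0.R'0N κ Φ (KS.NQ Φ) t p D mk : ℤ) + 2) ≤ (nL κ Φ t p D g f : ℤ) := by exact_mod_cast hnA
  have hk' : (k : ℤ) + 1 ≤ 1000 * (Neg.Kq κ : ℤ) := by exact_mod_cast hk
  have hR0 : (0 : ℤ) ≤ (KS0.R'0N κ Φ (KS.NQ Φ) t p D mk : ℤ) := Nat.cast_nonneg _
  have hKq : (1 : ℤ) ≤ (Neg.Kq κ : ℤ) := by exact_mod_cast Neg.one_le_Kq κ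
  have h1 : ((k : ℤ) + 1) * (KS0.R'0N κ Φ (KS.NQ Φ) t p D mk : ℤ) ≤ (1000 * (Neg.Kq κ : ℤ)) * (KS0.R'0N κ Φ (KS.NQ Φ) t p D mk : ℤ) := mul_le_mul_of_nonneg_right hk' hR0
  rw [hq3]
  nlinarith

/-- **`FT5` at the (ζ′) y′-face tuple** (`k₀ := 3`; `i` the transverse index): the lower axis-`0` reading of tangential region `k` (sign `σT`) is above `−fw`, given the
run-position fact `hlo : −fw + 10u₀ + 2 ≤ FcA yT + σT·u₀·k`. [cite: KozmaNitzan2024, §4 Lemma 12 (pp. 23–25)] -/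
theorem FT5_YA (κ : Consts) {V : Type} [DecidableEq V] [Countable V] {G : SimpleGraph V} [G.LocallyFinite] (Φ : PlanarSkeletonFrmQuasi G) (t : V) (p : unitInterval) (D : Skelφ.StepI.DataNS V) (g : ℕ) (f : ℕ) (P : PCells2T) (icr : Fin 2) (mk : ℕ) (hN : EqNumL κ Φ t p D g f) (hκ : (hL κ Φ t p D g f).natAbs ≤ 10 * nL κ Φ t p D g f)
    (hnA : 2000 * Neg.Kq κ * (KS0.R'0N κ Φ (KS.NQ Φ) t p D mk + 2) ≤ nL κ Φ t p D g f) (hℓ : 22000 * Neg.Kq κ * (KS0.R'0N κ Φ (KS.NQ Φ) t p D mk + 2) ≤ ℓL κ Φ t p D g f)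
    (yT x z : Site 2) (i : Fin 2) {σT : ℤ} (hσT : σT = 1 ∨ σT = -1) {k : ℕ} (hk : k + 1 ≤ 1000 * Neg.Kq κ)
    (hlo : -(5 * (P.r i : ℤ) - 4 - 3 - P.c icr - |z i - P.cenS x i|) + 10 * u₀A κ Φ t p D g f + 2 ≤
      FcA κ Φ t p D g f yT + σT * u₀A κ Φ t p D g f * (k : ℤ)) :
    (nL κ Φ t p D g f : ℤ) * modulus (nL κ Φ t p D g f) (hL κ Φ t p D g f) (vL κ Φ t p D g f) (vβL κ Φ t p D g f) *
        (-(5 * (P.r i : ℤ) - 4 - 3 - P.c icr - |z i - P.cenS x i|) - FcA κ Φ t p D g f yT) ≤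
      u₀A κ Φ t p D g f * modulus (nL κ Φ t p D g f) (hL κ Φ t p D g f) (vL κ Φ t p D g f) (vβL κ Φ t p D g f) *
            xSLo (nL κ Φ t p D g f) (qB3YA κ Φ t p D g f (KS0.R'0N κ Φ (KS.NQ Φ) t p D mk)) (KS0.R'0N κ Φ (KS.NQ Φ) t p D mk) σT k -
          u₀A κ Φ t p D g f * (nL κ Φ t p D g f : ℤ) * (shearUnit (nL κ Φ t p D g f) (hL κ Φ t p D g f) : ℤ) *
            (xBoxB (nL κ Φ t p D g f) (ℓL κ Φ t p D g f) (hL κ Φ t p D g f) (KS0.R'0N κ Φ (KS.NQ Φ) t p D mk) k + 1) -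
        u₀A κ Φ t p D g f * (nL κ Φ t p D g f : ℤ) -
        (nL κ Φ t p D g f : ℤ) * modulus (nL κ Φ t p D g f) (hL κ Φ t p D g f) (vL κ Φ t p D g f) (vβL κ Φ t p D g f) := by
  obtain ⟨hn1, hℓ1⟩ := one_le_of_eqNumL κ Φ t p D g f hN
  have hm2 := two_le_modulus κ Φ t p D g f mk hN hℓ
  have hu : 1 ≤ u₀A κ Φ t p D g f := (units_eqA κ Φ t p D g f).2.2.2.2.1
  have hn : (1 : ℤ) ≤ (nL κ Φ t p D g f : ℤ) := by exact_mod_cast hn1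
  have hsl := slant_leR0 κ Φ t p D g f mk hN hκ hℓ hk
    (mul_nonneg (by linarith : 0 ≤ u₀A κ Φ t p D g f) (by linarith : (0 : ℤ) ≤ (nL κ Φ t p D g f : ℤ)))
  have hQ := xSBox_hw_le κ Φ t p D g f mk hnA hk
  obtain ⟨eLo, -⟩ := xSBox_eq (nL κ Φ t p D g f) (qB3YA κ Φ t p D g f (KS0.R'0N κ Φ (KS.NQ Φ) t p D mk)) (KS0.R'0N κ Φ (KS.NQ Φ) t p D mk) k hσT
  rw [eLo]
  clear eLo hℓ hk hκ hnA
  set n : ℤ := (nL κ Φ t p D g f : ℤ)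
  set m := modulus (nL κ Φ t p D g f) (hL κ Φ t p D g f) (vL κ Φ t p D g f) (vβL κ Φ t p D g f)
  set u := u₀A κ Φ t p D g f
  set F := FcA κ Φ t p D g f yT
  set S := (shearUnit (nL κ Φ t p D g f) (hL κ Φ t p D g f) : ℤ) * (xBoxB (nL κ Φ t p D g f) (ℓL κ Φ t p D g f) (hL κ Φ t p D g f) (KS0.R'0N κ Φ (KS.NQ Φ) t p D mk) k + 1)
  set Q := ((qB3YA κ Φ t p D g f (KS0.R'0N κ Φ (KS.NQ Φ) t p D mk) : ℕ) : ℤ) + ((k : ℤ) + 1) * (KS0.R'0N κ Φ (KS.NQ Φ) t p D mk : ℕ) + n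
  set fw := 5 * (P.r i : ℤ) - 4 - 3 - P.c icr - |z i - P.cenS x i|
  have hnm : 0 ≤ n * m := mul_nonneg (by linarith) (by linarith)
  have hum : 0 ≤ u * m := mul_nonneg (by linarith) (by linarith)
  have p1 : n * m * (-fw - F) ≤ n * m * (σT * u * (k : ℤ) - 10 * u - 2) := mul_le_mul_of_nonneg_left (by linarith) hnm
  have p2 : u * m * Q ≤ u * m * (4 * n) := mul_le_mul_of_nonneg_left hQ hum
  have p3 : u * n * 1 ≤ u * n * m := mul_le_mul_of_nonneg_left (by linarith) (mul_nonneg (by linarith) (by linarith))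
  have e1 : u * m * (σT * ((k : ℤ) * n) - Q) = n * m * (σT * u * (k : ℤ)) - u * m * Q := by ring
  rw [e1]
  nlinarith [p1, p2, p3, hsl, hnm, hum]

/-- **`FT6` at the (ζ′) y′-face tuple** (`k₀ := 3`): the upper axis-`0` reading of tangential region `k` is below `fw`, given
`hhi : FcA yT + σT·u₀·k + 10u₀ + 2 ≤ fw`. [cite: KozmaNitzan2024, §4 Lemma 12 (pp. 23–25)] -/
theorem FT6_YA (κ : Consts) {V : Type} [DecidableEq V] [Countable V] {G : SimpleGraph V} [G.LocallyFinite] (Φ : PlanarSkeletonFrmQuasi G) (t : V) (p : unitInterval) (D : Skelφ.StepI.DataNS V) (g : ℕ) (f : ℕ) (P : PCells2T) (icr : Fin 2) (mk : ℕ) (hN : EqNumL κ Φ t p D g f) (hκ : (hL κ Φ t p D g f).natAbs ≤ 10 * nL κ Φ t p D g f)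
    (hnA : 2000 * Neg.Kq κ * (KS0.R'0N κ Φ (KS.NQ Φ) t p D mk + 2) ≤ nL κ Φ t p D g f) (hℓ : 22000 * Neg.Kq κ * (KS0.R'0N κ Φ (KS.NQ Φ) t p D mk + 2) ≤ ℓL κ Φ t p D g f)
    (yT x z : Site 2) (i : Fin 2) {σT : ℤ} (hσT : σT = 1 ∨ σT = -1) {k : ℕ} (hk : k + 1 ≤ 1000 * Neg.Kq κ)
    (hhi : FcA κ Φ t p D g f yT + σT * u₀A κ Φ t p D g f * (k : ℤ) + 10 * u₀A κ Φ t p D g f + 2 ≤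
      5 * (P.r i : ℤ) - 4 - 3 - P.c icr - |z i - P.cenS x i|) :
    (nL κ Φ t p D g f : ℤ) * modulus (nL κ Φ t p D g f) (hL κ Φ t p D g f) (vL κ Φ t p D g f) (vβL κ Φ t p D g f) * (FcA κ Φ t p D g f yT + 1) +
          u₀A κ Φ t p D g f * modulus (nL κ Φ t p D g f) (hL κ Φ t p D g f) (vL κ Φ t p D g f) (vβL κ Φ t p D g f) *
            xSHi (nL κ Φ t p D g f) (qB3YA κ Φ t p D g f (KS0.R'0N κ Φ (KS.NQ Φ) t p D mk)) (KS0.R'0N κ Φ (KS.NQ Φ) t p D mk) σT k +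
        u₀A κ Φ t p D g f * (nL κ Φ t p D g f : ℤ) * (shearUnit (nL κ Φ t p D g f) (hL κ Φ t p D g f) : ℤ) *
          (xBoxB (nL κ Φ t p D g f) (ℓL κ Φ t p D g f) (hL κ Φ t p D g f) (KS0.R'0N κ Φ (KS.NQ Φ) t p D mk) k + 1) ≤
      (nL κ Φ t p D g f : ℤ) * modulus (nL κ Φ t p D g f) (hL κ Φ t p D g f) (vL κ Φ t p D g f) (vβL κ Φ t p D g f) *
        (5 * (P.r i : ℤ) - 4 - 3 - P.c icr - |z i - P.cenS x i|) := by
  obtain ⟨hn1, hℓ1⟩ := one_le_of_eqNumL κ Φ t p D g f hN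
  have hm2 := two_le_modulus κ Φ t p D g f mk hN hℓ
  have hu : 1 ≤ u₀A κ Φ t p D g f := (units_eqA κ Φ t p D g f).2.2.2.2.1
  have hn : (1 : ℤ) ≤ (nL κ Φ t p D g f : ℤ) := by exact_mod_cast hn1
  have hsl := slant_leR0 κ Φ t p D g f mk hN hκ hℓ hk
    (mul_nonneg (by linarith : 0 ≤ u₀A κ Φ t p D g f) (by linarith : (0 : ℤ) ≤ (nL κ Φ t p D g f : ℤ)))
  have hQ := xSBox_hw_le κ Φ t p D g f mk hnA hk
  obtain ⟨-, eHi⟩ := xSBox_eq (nL κ Φ t p D g f) (qB3YA κ Φ t p D g f (KS0.R'0N κ Φ (KS.NQ Φ) t p D mk)) (KS0.R'0N κ Φ (KS.NQ Φ) t p D mk) k hσT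
  rw [eHi]
  clear eHi hℓ hk hκ hnA
  set n : ℤ := (nL κ Φ t p D g f : ℤ)
  set m := modulus (nL κ Φ t p D g f) (hL κ Φ t p D g f) (vL κ Φ t p D g f) (vβL κ Φ t p D g f)
  set u := u₀A κ Φ t p D g f
  set F := FcA κ Φ t p D g f yT
  set S := (shearUnit (nL κ Φ t p D g f) (hL κ Φ t p D g f) : ℤ) * (xBoxB (nL κ Φ t p D g f) (ℓL κ Φ t p D g f) (hL κ Φ t p D g f) (KS0.R'0N κ Φ (KS.NQ Φ) t p D mk) k + 1)
  set Q := ((qB3YA κ Φ t p D g f (KS0.R'0N κ Φ (KS.NQ Φ) t p D mk) : ℕ) : ℤ) + ((k : ℤ) + 1) * (KS0.R'0N κ Φ (KS.NQ Φ) t p D mk : ℕ) + n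
  set fw := 5 * (P.r i : ℤ) - 4 - 3 - P.c icr - |z i - P.cenS x i|
  have hnm : 0 ≤ n * m := mul_nonneg (by linarith) (by linarith)
  have hum : 0 ≤ u * m := mul_nonneg (by linarith) (by linarith)
  have p1 : n * m * (F + σT * u * (k : ℤ) + 10 * u + 2) ≤ n * m * fw := mul_le_mul_of_nonneg_left hhi hnm
  have p2 : u * m * Q ≤ u * m * (4 * n) := mul_le_mul_of_nonneg_left hQ hum
  have e1 : u * m * (σT * ((k : ℤ) * n) + Q) = n * m * (σT * u * (k : ℤ)) + u * m * Q := by ring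
  rw [e1]
  nlinarith [p1, p2, hsl, hnm, hum]

end FloorsTY

end KS

end NegB

end PlanarSkeletonFrmQuasi

end Summit.CriticalPhenomena.PercolationContinuityZ3.Theorems.Transplant

end
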